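import Mathlib
import Summits.Ventures.PercRepro.TriangleCapStarFamilyExact
import Summits.Ventures.PercRepro.TriangleCapElseSmallResidue

/-!
# PercRepro — THE DEEP SUB-BAND BOTTOM FOR EVERY RESIDUE, `t ≥ D²` (p3, gen 56; part 327)

The capstone of parts 296–326: for `t = m D + r`, `1 ≤ r ≤ D − 1`, `D ≤ m`, `m + 1 ≤ ℓ`, `2 t ≤ s`, whenever
`(2 r ≤ D ∧ m ≥ D + r − 1) ∨ (D < 2 r ∧ m ≥ D + r − 2) ∨ r = D − 1`, the bottom of the deep sub-band `u = t − D`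
on ALL graphs of the band on `ℓ + 1 + (s − t)` vertices is
`C(t,2) − t (D − 1) + μ (D − 2 μ + 1)`, `μ = min(r, D − r)` (`deep_bottom_exact`) — the residue minimum of part 312,
attained by the star family (parts 319) or, at `r = D − 1`, by the near-regular witness (part 313).  By parts
321–323 the condition is exact for `2 ≤ r ≤ D − 2`; `r = 1` is the first regime at `m ≥ D`; `r = 0` is the regular
cell of part 296 (`regular_bound_tight`, value `0`).  Axioms: standard.
-/

namespace PercRepro

namespace TriangleCap

namespace C047

open Finset

/-- **THE DEEP SUB-BAND BOTTOM FOR EVERY RESIDUE `1 ≤ r < D`:** under the threshold condition, every graph on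
`ℓ + 1 + (s − t)` vertices with a vertex of degree `s − t` and every off-degree `≤ D` has
`t (t − 1) + 2 μ (D − 2 μ + 1) ≤ 2 j + 2 t (D − 1)`, `μ = min(r, D − r)`, and a graph of the band with maximum
off-degree exactly `D` attains it. -/
theorem deep_bottom_exact (s ℓ m r D : ℕ) (hr : 1 ≤ r) (hrD : r < D) (hDm : D ≤ m) (hmℓ : m + 1 ≤ ℓ)
    (hs : 2 * (m * D + r) ≤ s)
    (hthr : (2 * r ≤ D ∧ D + r ≤ m + 1) ∨ (D < 2 * r ∧ D + r ≤ m + 2) ∨ r + 1 = D) :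
    (∀ (H : SimpleGraph (Fin (ℓ + 1 + (s - (m * D + r))))) [DecidableRel H.Adj], H.CliqueFree 3 →
      H.edgeFinset.card = s → ∀ w, deg H w + (m * D + r) = s → (∀ v, offDeg H w v ≤ D) →
      ∀ j, ∑ v, deg H v * deg H v + 2 * ((m * D + r) * (s - (m * D + r) - 1)) + 2 * j = s * (s + 1) →
      (m * D + r) * (m * D + r - 1) + 2 * (min r (D - r) * (D - 2 * min r (D - r) + 1)) ≤
        2 * j + 2 * ((m * D + r) * (D - 1))) ∧
    (∃ (H : SimpleGraph (Fin (ℓ + 1 + (s - (m * D + r))))) (_ : DecidableRel H.Adj), H.CliqueFree 3 ∧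
      H.edgeFinset.card = s ∧ ∃ w, deg H w + (m * D + r) = s ∧ (∀ v, offDeg H w v ≤ D) ∧
        (∃ x, ¬ H.Adj w x ∧ offDeg H w x = D) ∧
        ∃ j, ∑ v, deg H v * deg H v + 2 * ((m * D + r) * (s - (m * D + r) - 1)) + 2 * j = s * (s + 1) ∧
          2 * j + 2 * ((m * D + r) * (D - 1)) =
            (m * D + r) * (m * D + r - 1) + 2 * (min r (D - r) * (D - 2 * min r (D - r) + 1))) := by
  rcases hthr with ⟨h2, hm⟩ | ⟨h2, hm⟩ | hpred
  · rw [min_eq_left (show r ≤ D - r by omega)]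
    exact else_bottom_exact_half s ℓ m r D hr h2 hm hmℓ hs
  · rw [min_eq_right (show D - r ≤ r by omega)]
    exact else_bottom_exact_upper s ℓ m r D (by omega) (by omega) hm hmℓ hs
  · have hrv : r = D - 1 := by omega
    subst hrv
    have e1 : D - (D - 1) = 1 := by omega
    have e2 : min (D - 1) 1 = 1 := min_eq_right (by omega)
    have e3 : 1 * (D - 2 * 1 + 1) = D - 1 := by omega
    rw [e1, e2, e3]
    exact else_bottom_exact_residue_pred s ℓ m D (by omega) hDm hmℓ hs

end C047

end TriangleCap

end PercRepro
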